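import Summits.BirchSwinnertonDyer.BirchSwinnertonDyer.Theorems.KolyvaginDepthDoorDepthTableRowKitNoTwistDepthTwo
import Summits.BirchSwinnertonDyer.BirchSwinnertonDyer.Theorems.KolyvaginDepthDoorDepthTableLambdaJoinRankThree
import Summits.BirchSwinnertonDyer.BirchSwinnertonDyer.Theorems.KolyvaginDepthDoorDepthTableOddPrimeKit
import Summits.BirchSwinnertonDyer.BirchSwinnertonDyer.Theorems.KolyvaginDepthDoorDepthTableGlobalMinimal
import Summits.BirchSwinnertonDyer.BirchSwinnertonDyer.Theorems.Rank1ResidualIntModelReduction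
import Literature.NumberTheory.EllipticCurves.ComplexMultiplicationNotSemistable
import HarnessLib

/-!
# Route `KolyvaginDepthDoor` — the depth table BEYOND RANK 2: the DEPTH-TWO ROW `5077a1`
# `(p, d_K, ℓ₁ℓ₂) = (5, −7, 229·349)`, twist-free and without Kolyvagin's structure theorem
# (crux `KolyvaginDepthSupply`, stmt-BirchSwinnertonDyer-21765)

Helper file (`--supports stmt-BirchSwinnertonDyer-21765 --as helper`); it closes nothing and BSD is
not proved by it.

`5077a1 = [0,0,1,−7,6]` (`N = Δ = 5077` prime) is the first curve of rank `3`; the tree proves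
`3 ≤ rank_ℤ E(ℚ)` in the kernel (`three_le_rank_of_mem_atlasR3A00`, rank-3 atlas) and g4's
`…LambdaJoinRankThree` typed the crux's clause there on the λ-side (modulo BCGS, Kolyvagin Thm. 4, …).
This file is the depth-side row in the hF-free, twist-point-free currency of this seat
(`depthRowTwo_noTwist_of_print_of_intModel_certificate`): the predicted first non-zero Kolyvagin class
sits at depth `2 = rank − 1`, i.e. on a product of TWO Kolyvagin primes. Concrete admissible data,
every side condition decided in the kernel:

* `p = 5` — `ρ̄_{E,5^m}` onto for all `m` (`hasSurjectiveModNGaloisRep_pow_5`: semistable,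
  `gcd(c₄, Δ) = gcd(336, 5077) = 1`; Mazur witness `a_3 = −3`, `X² + 3X + 3` root-free mod `5`; the
  multiplicative prime `5077 ∥ Δ` with `5 ∤ 1` lifts the image to `GL₂(ℤ/5^m)`);
* `¬ CM` (`not_hasCM`: multiplicative reduction at `5077`);
* `K = ℚ(√−7)`: `(−7/5077) = 1`, so `5077` splits (Heegner hypothesis, `heegner_neg7`); `5 ∤ 7`;
* the two smallest Kolyvagin primes for `(5077a1, 5, −7)`: `ℓ₁ = 229` (`(−7/229) = −1`, `5 ∣ 230`,
  `#Ẽ(𝔽₂₂₉) = 240`, `a₂₂₉ = −10`) and `ℓ₂ = 349` (`(−7/349) = −1`, `5 ∣ 350`, `#Ẽ(𝔽₃₄₉) = 385`,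
  `a₃₄₉ = −35`) — point counts by the tree's `ℕ`-arithmetic Euler count (`card_229`, `card_349`).

* `C5077a1.depthRow_5_neg7_229_349_noTwist` — **THE RANK-3 ROW**: for ANY imaginary quadratic `K` with
  `d_K = −7`, any frame `(Dt, β, ι)` and any COMPATIBLE system `d n` of Kolyvagin–Heegner data, granted the
  five named McCallum/Gross leaves: IF the depth-2 class `(d (229·349)).kolyvaginClass _ 1 ≠ 0` (the bit a
  rank-3 depth computation would have to find: `P(229·349) ∉ 5·E(K[229·349])`), THEN
  `corank_{ℤ_5} Ш(E)[5^∞] = 0`, `rank_ℤ E(ℚ) = 3`, `rank_ℤ E^{(−7)}(ℚ) ≤ 2`, `E(ℚ)[5] = 0`, `Ш(E/ℚ)[5] = 0`,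
  `#Sel^(5)(E/ℚ) = 125`, `#Sel^(5)(E^{(−7)}/ℚ) ≤ 25`.

HONEST FRAMING: the JLS computation at conductor `229·349` (degree `230·350·h_K` over `K`) is far beyond
the rank-2 table's cost; the row records the SHAPE and the exact kernel-certified side conditions, not a
computed bit. Per-curve; CONDITIONAL on the five named facts, the compatible system and the bit; BSD is
not proved by it.

References: [CremonaAlgorithms1997] Table 1 (5077a1); [Kolyvagin1991MathAnn] Thm. 2.3; [GrossLMS1991]
§5 (5.1), §10; [McCallumLMS1991] §§2–5; [WZhang2014] Notations (xii); [Serre1972] §5.4 Prop. 21.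
-/

set_option linter.dupNamespace false

noncomputable section

open scoped Classical NumberField

namespace Summit.BirchSwinnertonDyer.BirchSwinnertonDyer.Theorems.KolyvaginDepthDoor

open Literature.NumberTheory.EllipticCurves Literature.NumberTheory.EllipticCurves.ModularForms
  Literature.NumberTheory.EllipticCurves.McCallum1991 WeierstrassCurve
open Summit.BirchSwinnertonDyer.BirchSwinnertonDyer.Theorems
open Summit.BirchSwinnertonDyer.BirchSwinnertonDyer.Rank2Observatory
open Summit.BirchSwinnertonDyer.BirchSwinnertonDyer.Rank1Residual
open Summit.BirchSwinnertonDyer.Rank1Residual.Additive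

namespace C5077a1

/-- The integral model `[0,0,1,−7,6]` of `5077a1` is the tree's `integralModelInt` of the atlas curve
`c5077a1.e ⊗ ℚ` (globally minimal; `IntModel.integralModelInt_eq_of_map_eq`).
[cite: CremonaAlgorithms1997, Table 1 (5077a1)] -/
theorem intModel :
    haveI := isElliptic_of_mem_atlasR3A00 mem_atlas;
    haveI := isGloballyMinimal_of_mem_atlasR3A00 mem_atlas;
    integralModelInt (c5077a1.e.baseChange ℚ) = ⟨0, 0, 1, -7, 6⟩ := by
  haveI := isElliptic_of_mem_atlasR3A00 mem_atlas
  haveI := isGloballyMinimal_of_mem_atlasR3A00 mem_atlas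
  exact IntModel.integralModelInt_eq_of_map_eq _ rfl

/-- **`5 ∈ B(5077a1)`: `ρ̄_{E,5^m}` is onto for every `m`** (unconditional): semistable
(`gcd(c₄, Δ) = 1`), `X² − a_3 X + 3` with `a_3 = −3` root-free mod `5` (`E[5]` irreducible, Mazur; onto,
Serre Prop. 21), and the multiplicative prime `5077 ∥ Δ` with `5 ∤ 1` (a transvection lifts the image to
`GL₂(ℤ/5^m)`). [cite: Serre1972, §5.4 Prop. 21] [cite: SerreAbelianLadic1968, Ch. IV §3.4] -/
theorem hasSurjectiveModNGaloisRep_pow_5 (m : ℕ) :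
    (c5077a1.e.baseChange ℚ).HasSurjectiveModNGaloisRep (5 ^ m : ℕ) := by
  have hn : ∀ t : ZMod 5, t ^ 2 - (((3 : ℕ) : ℤ) + 1 - (7 : ℕ) : ℤ) * t + ((3 : ℕ) : ZMod 5) ≠ 0 := by
    decide +kernel
  haveI := isElliptic_of_mem_atlasR3A00 mem_atlas
  haveI := isGloballyMinimal_of_mem_atlasR3A00 mem_atlas
  haveI := Fact.mk (by norm_num : Nat.Prime 5)
  haveI := Fact.mk (by norm_num : Nat.Prime 3)
  exact hasSurjectiveModNGaloisRep_pow_of_intModel_certificate intModel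
    (by rw [Int.isCoprime_iff_gcd_eq_one]; decide +kernel) 5 3 (by norm_num) (by decide +kernel)
    (n := 7) card_3 hn 5077 (by norm_num) (by norm_num) (by decide +kernel) (by decide +kernel)
    (e := 1) (by decide +kernel) (by decide +kernel) (by decide +kernel) m

/-- **`5077a1` is not CM** (unconditional): multiplicative reduction at `5077` (`5077 ∣ Δ = 5077`,
`5077 ∤ c₄ = 336`), while a CM curve over `ℚ` has no multiplicative prime (integral `j`).
[cite: SilvermanATAEC1994, Thm. II.6.4 (PDF p. 148)] [cite: CremonaAlgorithms1997, Table 1 (5077a1)] -/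
theorem not_hasCM :
    haveI := isElliptic_of_mem_atlasR3A00 mem_atlas;
    ¬ (c5077a1.e.baseChange ℚ).HasCM := by
  haveI := isElliptic_of_mem_atlasR3A00 mem_atlas
  haveI := isGloballyMinimal_of_mem_atlasR3A00 mem_atlas
  haveI := Fact.mk (by norm_num : Nat.Prime 5077)
  intro hCM
  exact not_hasMultiplicativeReductionAtPrime_of_hasCM _ hCM 5077
    (IntModel.hasMultiplicativeReductionAtPrime_of_intModel intModel 5077 (by decide +kernel)
      (by decide +kernel))

/-- **Heegner data `d_K = −7` for `5077a1`**: the only prime of `Δ = 5077` splits in a quadratic field of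
discriminant `−7` (`(−7/5077) = 1`). [cite: Marcus1977, Ch. 3 Thm. 25] [cite: GrossLMS1991, §1] -/
theorem heegner_neg7 : ∀ q : ℕ, q.Prime → (q : ℤ) ∣ (⟨0, 0, 1, -7, 6⟩ : WeierstrassCurve ℤ).Δ →
    (q = 2 → (-7 : ℤ) % 8 = 1) ∧ (q ≠ 2 → jacobiSym (-7) q = 1) :=
  forall_prime_dvd_of_natAbs_eq_pow (a := 5077) (i := 1) (by decide +kernel) (by norm_num)
    ⟨by norm_num, by norm_num⟩

/-- `#Ẽ(𝔽₂₂₉) = 240`, `a₂₂₉ = −10` (Kolyvagin prime for `(5, −7)`: `(−7/229) = −1`, `5 ∣ 230`, `5 ∣ a₂₂₉`),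
kernel-decided (`ℕ`-arithmetic Euler count `PointCountNat.natCard_point_map_eq`).
[cite: CremonaAlgorithms1997, Table 1 (5077a1)] -/
theorem card_229 :
    Nat.card (((⟨0, 0, 1, -7, 6⟩ : WeierstrassCurve ℤ).map (Int.castRingHom (ZMod 229))).toAffine.Point) =
      240 := by
  rw [PointCountNat.natCard_point_map_eq (hℓ := ⟨by norm_num⟩) (by norm_num) 0 0 1 (-7) 6
    (by decide +kernel)]
  decide +kernel

/-- `#Ẽ(𝔽₃₄₉) = 385`, `a₃₄₉ = −35` (Kolyvagin prime for `(5, −7)`: `(−7/349) = −1`, `5 ∣ 350`, `5 ∣ a₃₄₉`),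
kernel-decided. [cite: CremonaAlgorithms1997, Table 1 (5077a1)] -/
theorem card_349 :
    Nat.card (((⟨0, 0, 1, -7, 6⟩ : WeierstrassCurve ℤ).map (Int.castRingHom (ZMod 349))).toAffine.Point) =
      385 := by
  rw [PointCountNat.natCard_point_map_eq (hℓ := ⟨by norm_num⟩) (by norm_num) 0 0 1 (-7) 6
    (by decide +kernel)]
  decide +kernel

/-- **`3 ≤ rank_ℤ E(ℚ)` for `5077a1 = c5077a1.e ⊗ ℚ`** (the tree's kernel census theorem
`three_le_rank_of_mem_atlasR3A00`, transported along `C.e ⊗ ℚ = C.row.curve`).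
[cite: CremonaAlgorithms1997, Table 1 (5077a1)] -/
theorem three_le_rank : 3 ≤ (c5077a1.e.baseChange ℚ).mordellWeilRank := by
  have hbc : c5077a1.e.baseChange ℚ = c5077a1.row.curve := by
    ext <;> simp [AtlasCurve3.e, Rank3Row.curve, WeierstrassCurve.baseChange]
  rw [hbc]
  exact three_le_rank_of_mem_atlasR3A00 mem_atlas

/-- **DEPTH-TWO ROW `5077a1`, `(p, d_K, ℓ₁ℓ₂) = (5, −7, 229·349)`, twist-free, without Kolyvagin's
structure theorem.** For `E = 5077a1` (rank `3`), ANY imaginary quadratic `K` with `d_K = −7`, any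
frame `(Dt, β, ι)` and any COMPATIBLE system `d n` of Kolyvagin–Heegner data (`hσ`, `hS₁`, `hS₂`,
`hemb`), granted the five named leaves (Gross Prop. 5.4 (2); McCallum Lemma 4.3, Prop. 4.4, Lemma 5.3,
Prop. 2.2): IF the depth-2 derived class on the two Kolyvagin primes `229, 349` does not vanish,
`(d (229 * 349)).kolyvaginClass _ 1 ≠ 0`, THEN `corank_{ℤ_5} Ш(E)[5^∞] = 0`, `rank_ℤ E(ℚ) = 3`,
`rank_ℤ E^{(−7)}(ℚ) ≤ 2`, `E(ℚ)[5] = 0`, `Ш(E/ℚ)[5] = 0`, `#Sel^(5)(E/ℚ) = 5³` and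
`#Sel^(5)(E^{(−7)}/ℚ) ≤ 5²`. Every side condition (`5 ∈ B(E)`, non-CM, Heegner hypothesis, both Kolyvagin
primes, `3 ≤ rank`) is a kernel theorem. CONDITIONAL on the five facts and the bit; per-curve; BSD is not
proved by it. [cite: Kolyvagin1991MathAnn, Thm. 2.3] [cite: McCallumLMS1991, §§2–5]
[cite: GrossLMS1991, §5 (5.1)] [cite: CremonaAlgorithms1997, Table 1 (5077a1)] -/
theorem depthRow_5_neg7_229_349_noTwist
    (h54 : sign_conjAct_kolyvaginClass) (h43 : lemma43_kolyvaginClass_mem_selmerLocalKer)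
    (h44 : prop44_localOrder_kolyvaginClass_mul_eq) (h53 : lemma53_selmer_eigen_dependent_at)
    (h22 : prop22_reciprocity_eigen_finset)
    (K : Type) [Field K] [NumberField K] (hK : IsImaginaryQuadratic K)
    (hD : NumberField.discr K = -7) :
    haveI := isElliptic_of_mem_atlasR3A00 mem_atlas;
    haveI := isGloballyMinimal_of_mem_atlasR3A00 mem_atlas;
    haveI : NeZero ((c5077a1.e.baseChange ℚ).conductorNorm ℤ) := neZero_conductorNorm_of_isElliptic _;
    ∀ (Dt : ModularParametrizationData (c5077a1.e.baseChange ℚ) ((c5077a1.e.baseChange ℚ).conductorNorm ℤ))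
      (β : ℤ) (ι : K →+* ℂ) (d : ∀ m : ℕ, KolyvaginHeegnerData Dt β ι m),
    (∀ (m l : ℕ), ∀ l' ∈ m.primeFactors, ∀ (x : ringClassField K ι m)
      (x' : ringClassField K ι (m * l)),
      (x : ℂ) = x' → (((d (m * l)).σ l' x' : ringClassField K ι (m * l)) : ℂ) = ((d m).σ l' x : ℂ)) →
    (∀ (m l : ℕ), ∀ s ∈ (d m).S, ∃ s' ∈ (d (m * l)).S, ∀ (x : ringClassField K ι m)
      (x' : ringClassField K ι (m * l)),
      (x : ℂ) = x' → ((s' x' : ringClassField K ι (m * l)) : ℂ) = (s x : ℂ)) →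
    (∀ (m l : ℕ), ∀ s' ∈ (d (m * l)).S, ∃ s ∈ (d m).S, ∀ (x : ringClassField K ι m)
      (x' : ringClassField K ι (m * l)),
      (x : ℂ) = x' → ((s' x' : ringClassField K ι (m * l)) : ℂ) = (s x : ℂ)) →
    (∀ (m l : ℕ) (x : ringClassField K ι m) (x' : ringClassField K ι (m * l)),
      (x : ℂ) = x' → (d (m * l)).emb x' = (d m).emb x) →
    (d (229 * 349)).kolyvaginClass (p := 5) (by norm_num) 1 ≠ 0 →
    (c5077a1.e.baseChange ℚ).shaCorank 5 = 0 ∧ (c5077a1.e.baseChange ℚ).mordellWeilRank = 3 ∧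
      ((c5077a1.e.baseChange ℚ).quadraticTwist ((-7 : ℤ) : ℚ)).mordellWeilRank ≤ 2 ∧
      (∀ P : (c5077a1.e.baseChange ℚ).toAffine.Point, 5 • P = 0 → P = 0) ∧
      (∀ x ∈ (c5077a1.e.baseChange ℚ).sha, 5 • x = 0 → x = 0) ∧
      Nat.card ↥(selmerGroup (c5077a1.e.baseChange ℚ) ((5 : ℕ) : ℤ)) = 5 ^ 3 ∧
      Nat.card ↥(selmerGroup ((c5077a1.e.baseChange ℚ).quadraticTwist ((-7 : ℤ) : ℚ))
        ((5 : ℕ) : ℤ)) ≤ 5 ^ 2 := by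
  haveI := isElliptic_of_mem_atlasR3A00 mem_atlas
  haveI := isGloballyMinimal_of_mem_atlasR3A00 mem_atlas
  haveI : NeZero ((c5077a1.e.baseChange ℚ).conductorNorm ℤ) := neZero_conductorNorm_of_isElliptic _
  intro Dt β ι d hσ hS₁ hS₂ hemb hne
  haveI := Fact.mk (by norm_num : Nat.Prime 5)
  exact depthRowTwo_noTwist_of_print_of_intModel_certificate intModel h54 h43 h44 h53 h22 not_hasCM
    three_le_rank 5 (by norm_num) hasSurjectiveModNGaloisRep_pow_5 K hK hD (by norm_num) (by norm_num)
    heegner_neg7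
    229 (by norm_num) (by norm_num) (by decide +kernel) (by norm_num) (by norm_num) (by norm_num)
    (by norm_num) (n₁ := 240) card_229 (by norm_num)
    349 (by norm_num) (by norm_num) (by decide +kernel) (by norm_num) (by norm_num) (by norm_num)
    (by norm_num) (n₂ := 385) card_349 (by norm_num) (by norm_num)
    Dt β ι d hσ hS₁ hS₂ hemb hne

end C5077a1

end Summit.BirchSwinnertonDyer.BirchSwinnertonDyer.Theorems.KolyvaginDepthDoor

end
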